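import Summits.AnomalousDissipation.AnomalousDissipation.Theorems.SawtoothPulseCascadeApproxSol58Lip
import Summits.AnomalousDissipation.AnomalousDissipation.Theorems.SawtoothPulseCascadeK3LocalisedClosureGlue
import Summits.AnomalousDissipation.AnomalousDissipation.Theorems.SawtoothPulseCascadePackaging58
import Summits.AnomalousDissipation.AnomalousDissipation.Theorems.SawtoothPulseCascadeDriftFreeClosure58

/-!
# The route's rung `Target` from `K1loc`, `K2″` and the per-phase Lipschitz cap (conditional certificate)
(route `AnomalousDissipation/SawtoothPulseCascade`; helper for the crux ApproxSol58 = stmt-AnomalousDissipation-19688)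

Sequel of `…ApproxSol58Lip` (kept apart because it must import the landed closers of `Packaging58`,
`DriftFreeClosure58` and the glue `K3LocalisedClosureGlue`, which themselves import the route file): with
`approxSol58_of_lipschitzCap` for the one open child of the split crux `K3LocalisedClosure`, the glue gives
`K3LocalisedClosure`, and `K3LocalisedClosure = K1LocalisedCascade → K2LinearisedCascadeGrowth → Target` gives the rung
`Target` from the three analytic inputs `K1LocalisedCascade` (stmt-AnomalousDissipation-19491),
`K2LinearisedCascadeGrowth` (K2″, stmt-AnomalousDissipation-19696) and the Lipschitz cap over the box (the lead's proposed
crux K2Lip — an open conjecture, NOT asserted anywhere in the tree).  Everything else on the route is kernel-checked.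
-/

set_option linter.dupNamespace false

noncomputable section

namespace Summit.AnomalousDissipation.AnomalousDissipation.Theorems.SawtoothPulseCascade.ApproxResponse

open Set
open Literature.Analysis Literature.Analysis.FunctionSpaces Literature.Analysis.FluidPDE
open Literature.Analysis.FluidPDE.SawtoothCascade
open Summit.AnomalousDissipation.AnomalousDissipation.Theorems.SawtoothPulseCascade

/-- **The split crux `K3LocalisedClosure` from the Lipschitz cap over the box**: the landed closers of its children
`Packaging58` (p457035 `packaging58_proof`), `DriftFreeClosure58` (p456711 `driftFreeClosure58_proof`) and of the glue
`K3LocalisedClosureGlue` (p457044 `k3LocalisedClosureGlue_proof`), with `approxSol58_of_lipschitzCap` for the one open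
child. -/
theorem k3LocalisedClosure_of_lipschitzCap
    (hLip58 : ∀ γ ∈ Set.Icc (5 : ℝ) 8, ∀ ρN ∈ Finset.Icc 2 7, ∃ G : ℝ, 0 ≤ G ∧ G < (γ ^ 2 - 3) ^ 2 ∧
      K2LipschitzGrowthClassical ⟨γ, 1 / 4, 2, 1, ρN⟩ G) :
    Summit.AnomalousDissipation.AnomalousDissipation.Theses.SawtoothPulseCascade.K3LocalisedClosure :=
  k3LocalisedClosureGlue_proof packaging58_proof (approxSol58_of_lipschitzCap hLip58) driftFreeClosure58_proof

/-- **The route's rung `Target` from the three analytic inputs**: the localised scalar crux `K1LocalisedCascade`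
(stmt-AnomalousDissipation-19491), the per-phase Kelvin–Helmholtz cap `K2LinearisedCascadeGrowth` (K2″,
stmt-AnomalousDissipation-19696) and the per-phase Lipschitz cap over the box (proposed crux K2Lip) imply the rung
`Target` (Brué–De Lellis Question 2.1 with a Hölder force) — everything else on the route is kernel-checked. -/
theorem target_of_lipschitzCap
    (hK1 : Summit.AnomalousDissipation.AnomalousDissipation.Theses.SawtoothPulseCascade.K1LocalisedCascade)
    (hK2 : Summit.AnomalousDissipation.AnomalousDissipation.Theses.SawtoothPulseCascade.K2LinearisedCascadeGrowth)
    (hLip58 : ∀ γ ∈ Set.Icc (5 : ℝ) 8, ∀ ρN ∈ Finset.Icc 2 7, ∃ G : ℝ, 0 ≤ G ∧ G < (γ ^ 2 - 3) ^ 2 ∧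
      K2LipschitzGrowthClassical ⟨γ, 1 / 4, 2, 1, ρN⟩ G) :
    Summit.AnomalousDissipation.AnomalousDissipation.Theses.SawtoothPulseCascade.Target :=
  k3LocalisedClosure_of_lipschitzCap hLip58 hK1 hK2

end Summit.AnomalousDissipation.AnomalousDissipation.Theorems.SawtoothPulseCascade.ApproxResponse

end
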